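import Literature.NumberTheory.EllipticCurves.PadicSeriesEvaluation
import Literature.NumberTheory.GaloisRepresentations.LubinTateTorsion
import Mathlib.NumberTheory.Padics.Complex
import HarnessLib

/-!
# `p`-adic evaluation of integral formal power series at points of a complete ultrametric
# normed `ℚ_p`-algebra (`ℂ_p`, finite extensions of `ℚ_p`)

Trunk T-NT-EC (`Literature/NumberTheory/EllipticCurves`). The tree's evaluation calculus
`PadicSeriesEvaluation.lean` (`padicEval`, `padicEval₂`: values in `ℚ_p` of series with coefficients
in `ℤ_p ⊂ ℚ_p` at points of the open unit disc of `ℚ_p`) VERBATIM for points of the open unit disc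
of any complete ultrametric normed field `L` which is a normed `ℚ_p`-algebra — the case the canonical
cyclotomic `p`-adic height over a number field `H` needs (`CanonicalPAdicHeightCyc.lean`: the sigma
series `Σ_p ∈ ℤ_p⟦t⟧` of `W ⊗ ℚ_p` summed at the images `σ z ∈ ℂ_p` of a parameter `z ∈ H` under
the embeddings `σ : H → ℂ_p`; Mathlib's `PadicComplex` `ℂ_[p]` is complete, ultrametric, a normed
`ℚ_p`-algebra and algebraically closed).

For `f = Σ aₙ Xⁿ ∈ ℚ_p⟦X⟧`, `F = Σ a_d u^{d₀} v^{d₁} ∈ ℚ_p⟦u, v⟧` and `t, u, v ∈ L` we define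
`padicAlgEval L f t = Σ' aₙ tⁿ ∈ L` and `padicAlgEval₂ L F u v = Σ' a_d u^{d₀} v^{d₁} ∈ L` (`tsum`s in
`L`, coefficients transported by `algebraMap ℚ_p L`; junk `0` off the domain of summability), and
prove that on INTEGRAL series (`IsPadicInt`) at points of norm `< 1` they are the values of Mathlib's
topological evaluation `MvPowerSeries.eval₂` into the closed unit ball `𝒪_L` of `L` — a complete,
Hausdorff, LINEARLY TOPOLOGISED ring (tree: `LubinTate.unitBall`, its `IsLinearTopology` instance) —
along the isometric coefficient map `ℤ_p → 𝒪_L`. Consequences, word for word as over `ℚ_p`: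
evaluation is a ring homomorphism (`padicAlgEval_mul`, `padicAlgEval₂_mul`, …), commutes with
substitution (`padicAlgEval_subst`, `padicAlgEval₂_subst`, `padicAlgEval₂_substPair`), satisfies the
ultrametric bounds `‖f(t)‖ ≤ 1`, `‖f(t)‖ ≤ ‖t‖` (no constant term), and extends `padicEval`
(`padicAlgEval_algebraMap`: `f(ι t) = ι(f(t))` for `t ∈ ℚ_p`).

## Main statements

* `coeffHom L : ℤ_p →+* 𝒪_L` (isometric, continuous); `unitBall_hasEval` (points of norm `< 1` are
  evaluable); `unitBall_eval₂_subst` (evaluation of `ℤ_p`-series in `𝒪_L` commutes with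
  substitution — Bourbaki, Algèbre IV §4 no. 3, by continuity in the series and agreement on
  polynomials, exactly as the tree's `padicInt_eval₂_subst`).
* `padicAlgEval_map`, `padicAlgEval₂_map` — the `tsum`s are Mathlib's `eval₂`.
* the evaluation calculus in one and two variables.

## References

* N. Bourbaki, *Algèbre*, Ch. IV §4 no. 3 (substitution and evaluation of formal power series).
* J. H. Silverman, *The Arithmetic of Elliptic Curves*, 2nd ed., IV.1 («the power series …
  converge for `z ∈ 𝓜`» — for the maximal ideal `𝓜` of ANY complete local ring), VII.2.2.
* B. Mazur, W. Stein, J. Tate, Doc. Math. Extra Vol. Coates (2006), §2.7–2.8 (σ_v over `K_v`).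
-/

noncomputable section

open Filter PowerSeries
open scoped Topology
open Literature.NumberTheory.GaloisRepresentations.LubinTate (unitBall mem_unitBall_iff
  isTopologicallyNilpotent_of_norm_lt_one)

namespace Literature.NumberTheory.EllipticCurves

variable {p : ℕ} [Fact p.Prime] (L : Type*) [NontriviallyNormedField L] [NormedAlgebra ℚ_[p] L]

/-- `‖ι x‖ = ‖x‖` for the structure map `ι = algebraMap ℚ_p L` (Mathlib `norm_algebraMap'`).
[folklore] -/
private theorem norm_algebraMap_padic (x : ℚ_[p]) : ‖algebraMap ℚ_[p] L x‖ = ‖x‖ :=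
  norm_algebraMap' L x

/-! ### Evaluation in `L`: definitions -/

section Defs

/-- **`f(t) = Σ' ι(aₙ) tⁿ ∈ L`** for `f = Σ aₙ Xⁿ ∈ ℚ_p⟦X⟧` and `t ∈ L` (a `tsum` in `L`, junk `0`
where the series is not summable; for `f` integral and `‖t‖ < 1` it is Mathlib's topological
evaluation in `𝒪_L`, `padicAlgEval_map`). For `L = ℚ_p` this is `padicEval`.
[Silverman AEC IV.1; Mazur–Stein–Tate 2006 §2.7 (σ_v on `E(K_v)`)] [cite: MazurSteinTate2006, §2.7 (PDF p. 11)] -/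
def padicAlgEval (f : ℚ_[p]⟦X⟧) (t : L) : L :=
  ∑' n : ℕ, algebraMap ℚ_[p] L (coeff n f) * t ^ n

/-- **`F(u, v) = Σ' ι(a_d) u^{d₀} v^{d₁} ∈ L`** for `F ∈ ℚ_p⟦X₀, X₁⟧` and `u, v ∈ L` (a `tsum` over
`Fin 2 →₀ ℕ`, junk `0` off the domain of summability). For `L = ℚ_p` this is `padicEval₂`.
[Silverman AEC IV.1] [cite: MazurSteinTate2006, §2.7 (PDF p. 11)] -/
def padicAlgEval₂ (F : MvPowerSeries (Fin 2) ℚ_[p]) (u v : L) : L :=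
  ∑' d : Fin 2 →₀ ℕ, algebraMap ℚ_[p] L (MvPowerSeries.coeff d F) * (u ^ d 0 * v ^ d 1)

variable {L}

/-- Unfolding `padicAlgEval`. [cite: SilvermanAEC2009, IV.1] -/
theorem padicAlgEval_def (f : ℚ_[p]⟦X⟧) (t : L) :
    padicAlgEval L f t = ∑' n : ℕ, algebraMap ℚ_[p] L (coeff n f) * t ^ n := rfl

/-- Unfolding `padicAlgEval₂`. [cite: SilvermanAEC2009, IV.1] -/
theorem padicAlgEval₂_def (F : MvPowerSeries (Fin 2) ℚ_[p]) (u v : L) :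
    padicAlgEval₂ L F u v =
      ∑' d : Fin 2 →₀ ℕ, algebraMap ℚ_[p] L (MvPowerSeries.coeff d F) * (u ^ d 0 * v ^ d 1) := rfl

/-- `X(t) = t`. [cite: SilvermanAEC2009, IV.1] -/
@[simp] theorem padicAlgEval_X (t : L) : padicAlgEval L (PowerSeries.X : ℚ_[p]⟦X⟧) t = t := by
  unfold padicAlgEval
  rw [tsum_eq_single 1 fun n hn => by rw [coeff_X, if_neg hn, map_zero, zero_mul]]
  simp

/-- `(C c)(t) = ι c`. [cite: SilvermanAEC2009, IV.1] -/
@[simp] theorem padicAlgEval_C (c : ℚ_[p]) (t : L) :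
    padicAlgEval L (PowerSeries.C c) t = algebraMap ℚ_[p] L c := by
  unfold padicAlgEval
  rw [tsum_eq_single 0 fun n hn => by rw [coeff_C, if_neg hn, map_zero, zero_mul]]
  simp

/-- `f(0) = ι f₀`. [cite: SilvermanAEC2009, IV.1] -/
@[simp] theorem padicAlgEval_zero_right (f : ℚ_[p]⟦X⟧) :
    padicAlgEval L f 0 = algebraMap ℚ_[p] L (constantCoeff f) := by
  unfold padicAlgEval
  rw [tsum_eq_single 0 fun n hn => by rw [zero_pow hn, mul_zero]]
  simp

/-- `1(t) = 1`. [cite: SilvermanAEC2009, IV.1] -/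
theorem padicAlgEval_one (t : L) : padicAlgEval L (1 : ℚ_[p]⟦X⟧) t = 1 := by
  rw [← map_one PowerSeries.C, padicAlgEval_C, map_one]

/-- `X₀(u, v) = u`, `X₁(u, v) = v`. [cite: SilvermanAEC2009, IV.1] -/
@[simp] theorem padicAlgEval₂_X (i : Fin 2) (u v : L) :
    padicAlgEval₂ L (MvPowerSeries.X i : MvPowerSeries (Fin 2) ℚ_[p]) u v = ![u, v] i := by
  classical
  unfold padicAlgEval₂
  rw [tsum_eq_single (Finsupp.single i 1) fun d hd => by
    rw [MvPowerSeries.coeff_X, if_neg hd, map_zero, zero_mul]]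
  rw [MvPowerSeries.coeff_X, if_pos rfl, map_one, one_mul]
  fin_cases i <;> simp

/-- `(C c)(u, v) = ι c`. [cite: SilvermanAEC2009, IV.1] -/
@[simp] theorem padicAlgEval₂_C (c : ℚ_[p]) (u v : L) :
    padicAlgEval₂ L (MvPowerSeries.C c : MvPowerSeries (Fin 2) ℚ_[p]) u v = algebraMap ℚ_[p] L c := by
  classical
  unfold padicAlgEval₂
  rw [tsum_eq_single 0 fun d hd => by rw [MvPowerSeries.coeff_C, if_neg hd, map_zero, zero_mul]]
  simp

/-- The series defining `f(t)` is summable for `f` integral and `‖t‖ < 1`. [cite: SilvermanAEC2009, IV.1] -/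
theorem summable_padicAlgEval [CompleteSpace L] {f : ℚ_[p]⟦X⟧} {t : L} (hf : IsPadicInt f)
    (ht : ‖t‖ < 1) : Summable fun n : ℕ => algebraMap ℚ_[p] L (coeff n f) * t ^ n := by
  refine Summable.of_norm_bounded (summable_geometric_of_lt_one (norm_nonneg t) ht) fun n => ?_
  rw [norm_mul, norm_pow, norm_algebraMap_padic]
  exact mul_le_of_le_one_left (pow_nonneg (norm_nonneg t) n) (isPadicInt_iff_coeff.mp hf n)

/-- `f(t)` is the sum of its series (integral `f`, `‖t‖ < 1`). [cite: SilvermanAEC2009, IV.1] -/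
theorem hasSum_padicAlgEval [CompleteSpace L] {f : ℚ_[p]⟦X⟧} {t : L} (hf : IsPadicInt f)
    (ht : ‖t‖ < 1) :
    HasSum (fun n : ℕ => algebraMap ℚ_[p] L (coeff n f) * t ^ n) (padicAlgEval L f t) :=
  (summable_padicAlgEval hf ht).hasSum

/-- **`padicAlgEval` extends `padicEval`**: `f(ι t) = ι(f(t))` for `t ∈ ℚ_p`, `‖t‖ < 1`, `f`
integral. [cite: SilvermanAEC2009, IV.1] -/
theorem padicAlgEval_algebraMap [CompleteSpace L] {f : ℚ_[p]⟦X⟧} (hf : IsPadicInt f) {t : ℚ_[p]}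
    (ht : ‖t‖ < 1) :
    padicAlgEval L f (algebraMap ℚ_[p] L t) = algebraMap ℚ_[p] L (padicEval f t) := by
  have h := (hasSum_padicEval hf ht).map (algebraMap ℚ_[p] L) (continuous_algebraMap ℚ_[p] L)
  have ht' : ‖algebraMap ℚ_[p] L t‖ < 1 := by rwa [norm_algebraMap_padic]
  refine (hasSum_padicAlgEval hf ht').unique ?_
  convert h using 1
  funext n
  simp only [Function.comp_apply, map_mul, map_pow]

end Defs

variable [IsUltrametricDist L]

/-! ### The coefficient map `ℤ_p → 𝒪_L` and evaluability in `𝒪_L` -/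

section UnitBall

/-- **The coefficient map `ℤ_p → 𝒪_L`**: `ℤ_p ⊂ ℚ_p → L` lands in the closed unit ball.
[cite: CasselsFrohlichANT1967, Ch. VI §3.2] -/
def coeffHom : ℤ_[p] →+* unitBall L :=
  ((algebraMap ℚ_[p] L).comp PadicInt.Coe.ringHom).codRestrict (unitBall L) fun x => by
    rw [mem_unitBall_iff, RingHom.comp_apply, norm_algebraMap_padic]
    exact PadicInt.norm_le_one x

/-- `coeffHom x = ι x` in `L`. [cite: SilvermanAEC2009, IV.1] -/
@[simp] theorem coe_coeffHom (x : ℤ_[p]) :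
    ((coeffHom L x : unitBall L) : L) = algebraMap ℚ_[p] L x := rfl

/-- `coeffHom` is continuous (it is `ι` restricted to `ℤ_p`). [cite: SilvermanAEC2009, IV.1] -/
theorem continuous_coeffHom : Continuous (coeffHom L : ℤ_[p] → unitBall L) := by
  refine continuous_induced_rng.mpr ?_
  change Continuous fun x : ℤ_[p] => algebraMap ℚ_[p] L (x : ℚ_[p])
  exact (continuous_algebraMap ℚ_[p] L).comp continuous_subtype_val

/-- Points of `𝒪_L` of norm `< 1` are evaluable (`PowerSeries.HasEval`). [cite: SilvermanAEC2009, IV.1] -/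
theorem unitBall_hasEval {t : unitBall L} (ht : ‖(t : L)‖ < 1) : PowerSeries.HasEval t :=
  (PowerSeries.hasEval_def t).mpr (isTopologicallyNilpotent_of_norm_lt_one L ht)

/-- Finite families of points of norm `< 1` are evaluable (`MvPowerSeries.HasEval`). [cite: SilvermanAEC2009, IV.1] -/
theorem unitBall_mvHasEval {τ : Type*} [Finite τ] {b : τ → unitBall L} (hb : ∀ i, ‖(b i : L)‖ < 1) :
    MvPowerSeries.HasEval b where
  hpow i := isTopologicallyNilpotent_of_norm_lt_one L (hb i)
  tendsto_zero := by
    rw [(Filter.cofinite_eq_bot_iff.mpr ‹Finite τ›)]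
    exact tendsto_bot

/-- The pair `(u, v)` of points of norm `< 1`, as an evaluable family on `Fin 2`. [cite: SilvermanAEC2009, IV.1] -/
theorem unitBall_hasEval_pair {u v : unitBall L} (hu : ‖(u : L)‖ < 1) (hv : ‖(v : L)‖ < 1) :
    MvPowerSeries.HasEval ![u, v] :=
  unitBall_mvHasEval L fun i => by fin_cases i <;> assumption

/-- A point of the open unit disc of `L` is (the image of) a point of `𝒪_L`. [cite: SilvermanAEC2009, IV.1] -/
theorem exists_unitBall_coe_eq_of_norm_lt_one {t : L} (ht : ‖t‖ < 1) :
    ∃ t' : unitBall L, (t' : L) = t ∧ ‖(t' : L)‖ < 1 :=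
  ⟨⟨t, (mem_unitBall_iff L).mpr ht.le⟩, rfl, ht⟩

variable {σ τ : Type*} {a : σ → MvPowerSeries τ ℤ_[p]} {b : τ → unitBall L} [CompleteSpace L]

open MvPowerSeries.WithPiTopology in

/-- **Evaluation in `𝒪_L` commutes with substitution** for power series with coefficients in `ℤ_p`:
`(subst a f)(b) = f(a(b))` (both sides are continuous in `f` and agree on polynomials; Mathlib's
`eval₂_unique`). The tree's `padicInt_eval₂_subst` with `𝒪_L` in place of `ℤ_p` as the target.
[cite: BourbakiAlgebraII2003, Ch. IV §4 no. 3 Prop. 4] [cite: SilvermanAEC2009, IV.1] -/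
theorem unitBall_eval₂_subst (ha : MvPowerSeries.HasSubst a) (hb : MvPowerSeries.HasEval b)
    (f : MvPowerSeries σ ℤ_[p]) :
    MvPowerSeries.eval₂ (coeffHom L) b (MvPowerSeries.subst a f) =
      MvPowerSeries.eval₂ (coeffHom L) (fun s => MvPowerSeries.eval₂ (coeffHom L) b (a s)) f := by
  have hφ := continuous_coeffHom (p := p) L
  have hc : Continuous (MvPowerSeries.eval₂Hom (φ := coeffHom L) hφ hb) := by
    rw [MvPowerSeries.coe_eval₂Hom]
    exact MvPowerSeries.continuous_eval₂ (φ := coeffHom L) hφ hb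
  have hb' : MvPowerSeries.HasEval fun s => MvPowerSeries.eval₂ (coeffHom L) b (a s) := by
    have := (ha.hasEval (S := ℤ_[p])).map hc
    rwa [MvPowerSeries.coe_eval₂Hom] at this
  have key := MvPowerSeries.eval₂_unique (φ := coeffHom L) hφ hb'
    (ε := fun f => MvPowerSeries.eval₂ (coeffHom L) b (MvPowerSeries.subst a f))
    ((MvPowerSeries.continuous_eval₂ (φ := coeffHom L) hφ hb).comp
      (mvPowerSeries_continuous_subst ha)) ?_
  · exact congr_fun key f
  · intro q
    rw [MvPowerSeries.subst_coe]
    induction q using MvPolynomial.induction_on with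
    | C r =>
      rw [MvPolynomial.aeval_C, MvPolynomial.eval₂_C, MvPowerSeries.algebraMap_apply,
        Algebra.algebraMap_self, MvPowerSeries.eval₂_C, RingHom.id_apply]
    | add f g hf hg =>
      rw [map_add, MvPolynomial.eval₂_add, ← hf, ← hg, ← MvPowerSeries.coe_eval₂Hom hφ hb, map_add]
    | mul_X f s hf =>
      rw [map_mul, MvPolynomial.aeval_X, MvPolynomial.eval₂_mul, MvPolynomial.eval₂_X, ← hf,
        ← MvPowerSeries.coe_eval₂Hom hφ hb, map_mul]

open MvPowerSeries.WithPiTopology in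
/-- The one-variable case: `(f.subst a)(b) = f(a(b))` for `f ∈ ℤ_p⟦X⟧` substituted with a
multivariate `a`, evaluated in `𝒪_L`. [cite: SilvermanAEC2009, IV.1] -/
theorem unitBall_eval₂_powerSeries_subst {a : MvPowerSeries τ ℤ_[p]}
    (ha : PowerSeries.HasSubst a) (hb : MvPowerSeries.HasEval b) (f : ℤ_[p]⟦X⟧) :
    MvPowerSeries.eval₂ (coeffHom L) b (f.subst a) =
      PowerSeries.eval₂ (coeffHom L) (MvPowerSeries.eval₂ (coeffHom L) b a) f :=
  unitBall_eval₂_subst L (PowerSeries.HasSubst.const ha) hb f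

end UnitBall

/-! ### The bridge to Mathlib's `eval₂` -/

section Eval

variable {L} [CompleteSpace L]

/-- **Bridge, one variable**: for `G ∈ ℤ_p⟦X⟧` and `t ∈ 𝒪_L` with `‖t‖ < 1`, `padicAlgEval` of
`G ⊗ ℚ_p` at `t` is Mathlib's `PowerSeries.eval₂` into `𝒪_L` along `coeffHom`. [cite: SilvermanAEC2009, IV.1] -/
theorem padicAlgEval_map (G : ℤ_[p]⟦X⟧) {t : unitBall L} (ht : ‖(t : L)‖ < 1) :
    padicAlgEval L (G.map PadicInt.Coe.ringHom) t =
      ((PowerSeries.eval₂ (coeffHom L) t G : unitBall L) : L) := by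
  have h := PowerSeries.hasSum_eval₂ (φ := coeffHom L) (continuous_coeffHom (p := p) L)
    (unitBall_hasEval L ht) G
  have h' := h.map (unitBall L).subtype.toAddMonoidHom continuous_subtype_val
  unfold padicAlgEval
  have hf : (fun n => algebraMap ℚ_[p] L (coeff n (G.map PadicInt.Coe.ringHom)) * (t : L) ^ n) =
      (⇑(unitBall L).subtype.toAddMonoidHom ∘ fun d => (coeffHom L) (coeff d G) * t ^ d) := by
    funext n
    rw [coeff_map_coe]; rfl
  rw [hf, h'.tsum_eq]; rfl

/-- **Bridge, two variables**: for `G ∈ ℤ_p⟦X₀, X₁⟧` and `u, v ∈ 𝒪_L` of norm `< 1`,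
`padicAlgEval₂` is Mathlib's `MvPowerSeries.eval₂` at `![u, v]` along `coeffHom`. [cite: SilvermanAEC2009, IV.1] -/
theorem padicAlgEval₂_map (G : MvPowerSeries (Fin 2) ℤ_[p]) {u v : unitBall L} (hu : ‖(u : L)‖ < 1)
    (hv : ‖(v : L)‖ < 1) :
    padicAlgEval₂ L (G.map PadicInt.Coe.ringHom) u v =
      ((MvPowerSeries.eval₂ (coeffHom L) ![u, v] G : unitBall L) : L) := by
  have h := MvPowerSeries.hasSum_eval₂ (φ := coeffHom L) (continuous_coeffHom (p := p) L)
    (unitBall_hasEval_pair L hu hv) G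
  have h' := h.map (unitBall L).subtype.toAddMonoidHom continuous_subtype_val
  unfold padicAlgEval₂
  have hf : (fun d : Fin 2 →₀ ℕ => algebraMap ℚ_[p] L (MvPowerSeries.coeff d (G.map PadicInt.Coe.ringHom)) *
      ((u : L) ^ d 0 * (v : L) ^ d 1)) =
      (⇑(unitBall L).subtype.toAddMonoidHom ∘ fun d =>
        (coeffHom L) (MvPowerSeries.coeff d G) * d.prod fun s e => ![u, v] s ^ e) := by
    funext d
    rw [mvCoeff_map_coe, Function.comp_apply, finsupp_prod_pow_fin_two]; rfl
  rw [hf, h'.tsum_eq]; rfl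

/-! ### Evaluation calculus, one variable -/

section OneVar

variable {f g : ℚ_[p]⟦X⟧} {t : L}

/-- **`‖f(t)‖ ≤ 1`** for `f` integral and `‖t‖ < 1`. [cite: SilvermanAEC2009, IV.1] -/
theorem norm_padicAlgEval_le_one (hf : IsPadicInt f) (ht : ‖t‖ < 1) : ‖padicAlgEval L f t‖ ≤ 1 := by
  obtain ⟨F, rfl⟩ := isPadicInt_iff_exists_powerSeries_map.mp hf
  obtain ⟨t, rfl, ht'⟩ := exists_unitBall_coe_eq_of_norm_lt_one L ht
  rw [padicAlgEval_map F ht']; exact (mem_unitBall_iff L).mp (SetLike.coe_mem _)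

omit [CompleteSpace L] in
/-- **`‖f(t)‖ ≤ ‖t‖`** for `f` integral WITHOUT CONSTANT TERM and `‖t‖ < 1` (every term
`aₙ tⁿ`, `n ≥ 1`, has norm `≤ ‖t‖`; ultrametric inequality). [cite: SilvermanAEC2009, IV.1] -/
theorem norm_padicAlgEval_le (hf : IsPadicInt f) (hf0 : constantCoeff f = 0) (ht : ‖t‖ < 1) :
    ‖padicAlgEval L f t‖ ≤ ‖t‖ := by
  unfold padicAlgEval
  refine IsUltrametricDist.norm_tsum_le_of_forall_le_of_nonneg (norm_nonneg t) fun n => ?_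
  rcases n with _ | n
  · simp [hf0]
  · rw [norm_mul, norm_pow, pow_succ, norm_algebraMap_padic]
    calc ‖coeff (n + 1) f‖ * (‖t‖ ^ n * ‖t‖) ≤ 1 * (1 * ‖t‖) := by
          gcongr
          · exact isPadicInt_iff_coeff.mp hf _
          · exact pow_le_one₀ (norm_nonneg t) ht.le
      _ = ‖t‖ := by ring

omit [CompleteSpace L] in
/-- In particular `‖f(t)‖ < 1`, so `f(t)` is again in the open unit disc. [cite: SilvermanAEC2009, IV.1] -/
theorem norm_padicAlgEval_lt_one (hf : IsPadicInt f) (hf0 : constantCoeff f = 0) (ht : ‖t‖ < 1) :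
    ‖padicAlgEval L f t‖ < 1 :=
  (norm_padicAlgEval_le hf hf0 ht).trans_lt ht

/-- `(f + g)(t) = f(t) + g(t)` (integral `f, g`, `‖t‖ < 1`). [cite: SilvermanAEC2009, IV.1] -/
theorem padicAlgEval_add (hf : IsPadicInt f) (hg : IsPadicInt g) (ht : ‖t‖ < 1) :
    padicAlgEval L (f + g) t = padicAlgEval L f t + padicAlgEval L g t := by
  obtain ⟨F, rfl⟩ := isPadicInt_iff_exists_powerSeries_map.mp hf
  obtain ⟨G, rfl⟩ := isPadicInt_iff_exists_powerSeries_map.mp hg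
  obtain ⟨t, rfl, ht'⟩ := exists_unitBall_coe_eq_of_norm_lt_one L ht
  rw [← map_add, padicAlgEval_map _ ht', padicAlgEval_map _ ht', padicAlgEval_map _ ht',
    ← PowerSeries.coe_eval₂Hom (continuous_coeffHom (p := p) L) (unitBall_hasEval L ht'), map_add,
    Subring.coe_add]

/-- `(-f)(t) = -f(t)`. [cite: SilvermanAEC2009, IV.1] -/
theorem padicAlgEval_neg (hf : IsPadicInt f) (ht : ‖t‖ < 1) :
    padicAlgEval L (-f) t = -padicAlgEval L f t := by
  obtain ⟨F, rfl⟩ := isPadicInt_iff_exists_powerSeries_map.mp hf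
  obtain ⟨t, rfl, ht'⟩ := exists_unitBall_coe_eq_of_norm_lt_one L ht
  rw [← map_neg, padicAlgEval_map _ ht', padicAlgEval_map _ ht',
    ← PowerSeries.coe_eval₂Hom (continuous_coeffHom (p := p) L) (unitBall_hasEval L ht'), map_neg,
    Subring.coe_neg]

/-- `(f - g)(t) = f(t) - g(t)`. [cite: SilvermanAEC2009, IV.1] -/
theorem padicAlgEval_sub (hf : IsPadicInt f) (hg : IsPadicInt g) (ht : ‖t‖ < 1) :
    padicAlgEval L (f - g) t = padicAlgEval L f t - padicAlgEval L g t := by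
  rw [sub_eq_add_neg, padicAlgEval_add hf hg.neg ht, padicAlgEval_neg hg ht, sub_eq_add_neg]

/-- **`(f g)(t) = f(t) g(t)`** (integral `f, g`, `‖t‖ < 1`). [cite: SilvermanAEC2009, IV.1] -/
theorem padicAlgEval_mul (hf : IsPadicInt f) (hg : IsPadicInt g) (ht : ‖t‖ < 1) :
    padicAlgEval L (f * g) t = padicAlgEval L f t * padicAlgEval L g t := by
  obtain ⟨F, rfl⟩ := isPadicInt_iff_exists_powerSeries_map.mp hf
  obtain ⟨G, rfl⟩ := isPadicInt_iff_exists_powerSeries_map.mp hg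
  obtain ⟨t, rfl, ht'⟩ := exists_unitBall_coe_eq_of_norm_lt_one L ht
  rw [← map_mul, padicAlgEval_map _ ht', padicAlgEval_map _ ht', padicAlgEval_map _ ht',
    ← PowerSeries.coe_eval₂Hom (continuous_coeffHom (p := p) L) (unitBall_hasEval L ht'), map_mul,
    Subring.coe_mul]

/-- `(fⁿ)(t) = f(t)ⁿ`. [cite: SilvermanAEC2009, IV.1] -/
theorem padicAlgEval_pow (hf : IsPadicInt f) (ht : ‖t‖ < 1) (n : ℕ) :
    padicAlgEval L (f ^ n) t = padicAlgEval L f t ^ n := by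
  obtain ⟨F, rfl⟩ := isPadicInt_iff_exists_powerSeries_map.mp hf
  obtain ⟨t, rfl, ht'⟩ := exists_unitBall_coe_eq_of_norm_lt_one L ht
  rw [← map_pow, padicAlgEval_map _ ht', padicAlgEval_map _ ht',
    ← PowerSeries.coe_eval₂Hom (continuous_coeffHom (p := p) L) (unitBall_hasEval L ht'), map_pow,
    SubmonoidClass.coe_pow]

/-- Inverses evaluate to inverses: if `f · g = 1` with `f, g` integral then `g(t) = f(t)⁻¹`
(`‖t‖ < 1`; e.g. `g = invOfUnit f u`). [cite: SilvermanAEC2009, IV.1] -/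
theorem padicAlgEval_eq_inv_of_mul_eq_one (hf : IsPadicInt f) (hg : IsPadicInt g) (hfg : f * g = 1)
    (ht : ‖t‖ < 1) : padicAlgEval L g t = (padicAlgEval L f t)⁻¹ := by
  have h := padicAlgEval_mul hf hg ht
  rw [hfg, padicAlgEval_one] at h
  exact (eq_inv_of_mul_eq_one_right h.symm)

/-- **Evaluation commutes with substitution, one variable**: `(f ∘ g)(t) = f(g(t))` for `f, g`
integral, `g(0) = 0`, `‖t‖ < 1`. [cite: BourbakiAlgebraII2003, Ch. IV §4 no. 3] [cite: SilvermanAEC2009, IV.1] -/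
theorem padicAlgEval_subst (hf : IsPadicInt f) (hg : IsPadicInt g) (hg0 : constantCoeff g = 0)
    (ht : ‖t‖ < 1) : padicAlgEval L (f.subst g) t = padicAlgEval L f (padicAlgEval L g t) := by
  have hgt : ‖padicAlgEval L g t‖ < 1 := norm_padicAlgEval_lt_one hg hg0 ht
  obtain ⟨F, rfl⟩ := isPadicInt_iff_exists_powerSeries_map.mp hf
  obtain ⟨G, rfl⟩ := isPadicInt_iff_exists_powerSeries_map.mp hg
  obtain ⟨t, rfl, ht'⟩ := exists_unitBall_coe_eq_of_norm_lt_one L ht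
  have hG0 : constantCoeff G = 0 := by
    apply PadicInt.coe_eq_zero.mp
    rw [← coeff_zero_eq_constantCoeff_apply, ← coeff_map_coe, coeff_zero_eq_constantCoeff_apply]
    exact hg0
  have hGs : PowerSeries.HasSubst G := PowerSeries.HasSubst.of_constantCoeff_zero' hG0
  rw [padicAlgEval_map G ht'] at hgt ⊢
  have hgt' : ‖((PowerSeries.eval₂ (coeffHom L) t G : unitBall L) : L)‖ < 1 := hgt
  rw [← powerSeries_map_subst hGs, padicAlgEval_map _ ht', padicAlgEval_map _ hgt']
  congr 1
  exact unitBall_eval₂_powerSeries_subst L hGs (PowerSeries.hasEval (unitBall_hasEval L ht')) F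

end OneVar

/-! ### Evaluation calculus, two variables -/

section TwoVar

variable {F G : MvPowerSeries (Fin 2) ℚ_[p]} {f : ℚ_[p]⟦X⟧} {u v : L}

/-- **`‖F(u, v)‖ ≤ 1`** for `F` integral and `‖u‖, ‖v‖ < 1`. [cite: SilvermanAEC2009, IV.1] -/
theorem norm_padicAlgEval₂_le_one (hF : IsPadicInt F) (hu : ‖u‖ < 1) (hv : ‖v‖ < 1) :
    ‖padicAlgEval₂ L F u v‖ ≤ 1 := by
  obtain ⟨F', rfl⟩ := isPadicInt_iff_exists_map.mp hF
  obtain ⟨u, rfl, hu'⟩ := exists_unitBall_coe_eq_of_norm_lt_one L hu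
  obtain ⟨v, rfl, hv'⟩ := exists_unitBall_coe_eq_of_norm_lt_one L hv
  rw [padicAlgEval₂_map F' hu' hv']; exact (mem_unitBall_iff L).mp (SetLike.coe_mem _)

omit [CompleteSpace L] in
/-- **`‖F(u, v)‖ ≤ max ‖u‖ ‖v‖ < 1`** for `F` integral without constant term. [cite: SilvermanAEC2009, IV.1] -/
theorem norm_padicAlgEval₂_lt_one (hF : IsPadicInt F) (hF0 : MvPowerSeries.constantCoeff F = 0)
    (hu : ‖u‖ < 1) (hv : ‖v‖ < 1) : ‖padicAlgEval₂ L F u v‖ < 1 := by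
  obtain ⟨r, hr0, hr1, hur, hvr⟩ : ∃ r : ℝ, 0 ≤ r ∧ r < 1 ∧ ‖u‖ ≤ r ∧ ‖v‖ ≤ r :=
    ⟨max ‖u‖ ‖v‖, le_max_of_le_left (norm_nonneg u), max_lt hu hv, le_max_left _ _,
      le_max_right _ _⟩
  refine lt_of_le_of_lt ?_ hr1
  unfold padicAlgEval₂
  refine IsUltrametricDist.norm_tsum_le_of_forall_le_of_nonneg hr0 fun d => ?_
  by_cases hd : d = 0
  · subst hd
    rw [MvPowerSeries.coeff_zero_eq_constantCoeff_apply, hF0, map_zero, zero_mul, norm_zero]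
    exact hr0
  · have hdeg : 1 ≤ d 0 + d 1 := by
      by_contra hlt
      apply hd
      have h0 : d 0 = 0 := by omega
      have h1 : d 1 = 0 := by omega
      ext i; fin_cases i <;> simp [h0, h1]
    rw [norm_mul, norm_mul, norm_pow, norm_pow, norm_algebraMap_padic]
    calc ‖MvPowerSeries.coeff d F‖ * (‖u‖ ^ d 0 * ‖v‖ ^ d 1)
        ≤ 1 * (r ^ d 0 * r ^ d 1) := by gcongr; exact hF d
      _ = r ^ (d 0 + d 1) := by rw [one_mul, pow_add]
      _ ≤ r ^ 1 := pow_le_pow_of_le_one hr0 hr1.le hdeg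
      _ = r := pow_one r

/-- `(F + G)(u,v) = F(u,v) + G(u,v)` (integral `F, G`, `‖u‖, ‖v‖ < 1`). [cite: SilvermanAEC2009, IV.1] -/
theorem padicAlgEval₂_add (hF : IsPadicInt F) (hG : IsPadicInt G) (hu : ‖u‖ < 1) (hv : ‖v‖ < 1) :
    padicAlgEval₂ L (F + G) u v = padicAlgEval₂ L F u v + padicAlgEval₂ L G u v := by
  obtain ⟨F', rfl⟩ := isPadicInt_iff_exists_map.mp hF
  obtain ⟨G', rfl⟩ := isPadicInt_iff_exists_map.mp hG
  obtain ⟨u, rfl, hu'⟩ := exists_unitBall_coe_eq_of_norm_lt_one L hu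
  obtain ⟨v, rfl, hv'⟩ := exists_unitBall_coe_eq_of_norm_lt_one L hv
  rw [← map_add, padicAlgEval₂_map _ hu' hv', padicAlgEval₂_map _ hu' hv',
    padicAlgEval₂_map _ hu' hv',
    ← MvPowerSeries.coe_eval₂Hom (continuous_coeffHom (p := p) L) (unitBall_hasEval_pair L hu' hv'), map_add,
    Subring.coe_add]

/-- `(-F)(u,v) = -F(u,v)`. [cite: SilvermanAEC2009, IV.1] -/
theorem padicAlgEval₂_neg (hF : IsPadicInt F) (hu : ‖u‖ < 1) (hv : ‖v‖ < 1) :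
    padicAlgEval₂ L (-F) u v = -padicAlgEval₂ L F u v := by
  obtain ⟨F', rfl⟩ := isPadicInt_iff_exists_map.mp hF
  obtain ⟨u, rfl, hu'⟩ := exists_unitBall_coe_eq_of_norm_lt_one L hu
  obtain ⟨v, rfl, hv'⟩ := exists_unitBall_coe_eq_of_norm_lt_one L hv
  rw [← map_neg, padicAlgEval₂_map _ hu' hv', padicAlgEval₂_map _ hu' hv',
    ← MvPowerSeries.coe_eval₂Hom (continuous_coeffHom (p := p) L) (unitBall_hasEval_pair L hu' hv'), map_neg,
    Subring.coe_neg]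

/-- `(F - G)(u,v) = F(u,v) - G(u,v)`. [cite: SilvermanAEC2009, IV.1] -/
theorem padicAlgEval₂_sub (hF : IsPadicInt F) (hG : IsPadicInt G) (hu : ‖u‖ < 1) (hv : ‖v‖ < 1) :
    padicAlgEval₂ L (F - G) u v = padicAlgEval₂ L F u v - padicAlgEval₂ L G u v := by
  rw [sub_eq_add_neg, padicAlgEval₂_add hF hG.neg hu hv, padicAlgEval₂_neg hG hu hv, sub_eq_add_neg]

/-- **`(F G)(u,v) = F(u,v) G(u,v)`** (integral `F, G`, `‖u‖, ‖v‖ < 1`). [cite: SilvermanAEC2009, IV.1] -/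
theorem padicAlgEval₂_mul (hF : IsPadicInt F) (hG : IsPadicInt G) (hu : ‖u‖ < 1) (hv : ‖v‖ < 1) :
    padicAlgEval₂ L (F * G) u v = padicAlgEval₂ L F u v * padicAlgEval₂ L G u v := by
  obtain ⟨F', rfl⟩ := isPadicInt_iff_exists_map.mp hF
  obtain ⟨G', rfl⟩ := isPadicInt_iff_exists_map.mp hG
  obtain ⟨u, rfl, hu'⟩ := exists_unitBall_coe_eq_of_norm_lt_one L hu
  obtain ⟨v, rfl, hv'⟩ := exists_unitBall_coe_eq_of_norm_lt_one L hv
  rw [← map_mul, padicAlgEval₂_map _ hu' hv', padicAlgEval₂_map _ hu' hv',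
    padicAlgEval₂_map _ hu' hv',
    ← MvPowerSeries.coe_eval₂Hom (continuous_coeffHom (p := p) L) (unitBall_hasEval_pair L hu' hv'), map_mul,
    Subring.coe_mul]

/-- `(Fⁿ)(u,v) = F(u,v)ⁿ`. [cite: SilvermanAEC2009, IV.1] -/
theorem padicAlgEval₂_pow (hF : IsPadicInt F) (hu : ‖u‖ < 1) (hv : ‖v‖ < 1) (n : ℕ) :
    padicAlgEval₂ L (F ^ n) u v = padicAlgEval₂ L F u v ^ n := by
  obtain ⟨F', rfl⟩ := isPadicInt_iff_exists_map.mp hF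
  obtain ⟨u, rfl, hu'⟩ := exists_unitBall_coe_eq_of_norm_lt_one L hu
  obtain ⟨v, rfl, hv'⟩ := exists_unitBall_coe_eq_of_norm_lt_one L hv
  rw [← map_pow, padicAlgEval₂_map _ hu' hv', padicAlgEval₂_map _ hu' hv',
    ← MvPowerSeries.coe_eval₂Hom (continuous_coeffHom (p := p) L) (unitBall_hasEval_pair L hu' hv'), map_pow,
    SubmonoidClass.coe_pow]

/-- **Evaluation commutes with substitution of a pair into one variable**:
`(f ∘ F)(u, v) = f(F(u, v))` for `f ∈ ℤ_p⟦X⟧`, `F ∈ ℤ_p⟦u, v⟧` without constant term.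
[cite: BourbakiAlgebraII2003, Ch. IV §4 no. 3] [cite: SilvermanAEC2009, IV.1] -/
theorem padicAlgEval₂_subst (hf : IsPadicInt f) (hF : IsPadicInt F)
    (hF0 : MvPowerSeries.constantCoeff F = 0) (hu : ‖u‖ < 1) (hv : ‖v‖ < 1) :
    padicAlgEval₂ L (f.subst F) u v = padicAlgEval L f (padicAlgEval₂ L F u v) := by
  have hFuv : ‖padicAlgEval₂ L F u v‖ < 1 := norm_padicAlgEval₂_lt_one hF hF0 hu hv
  obtain ⟨f', rfl⟩ := isPadicInt_iff_exists_powerSeries_map.mp hf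
  obtain ⟨F', rfl⟩ := isPadicInt_iff_exists_map.mp hF
  obtain ⟨u, rfl, hu'⟩ := exists_unitBall_coe_eq_of_norm_lt_one L hu
  obtain ⟨v, rfl, hv'⟩ := exists_unitBall_coe_eq_of_norm_lt_one L hv
  have hF0' : MvPowerSeries.constantCoeff F' = 0 := by
    apply PadicInt.coe_eq_zero.mp
    rw [MvPowerSeries.constantCoeff_map] at hF0
    exact hF0
  have hFs : PowerSeries.HasSubst F' := PowerSeries.HasSubst.of_constantCoeff_zero hF0'
  rw [padicAlgEval₂_map F' hu' hv'] at hFuv ⊢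
  have hFuv' : ‖((MvPowerSeries.eval₂ (coeffHom L) ![u, v] F' : unitBall L) : L)‖ < 1 := hFuv
  rw [← PowerSeries.map_subst hFs, padicAlgEval₂_map _ hu' hv', padicAlgEval_map _ hFuv']
  congr 1
  exact unitBall_eval₂_powerSeries_subst L hFs (unitBall_hasEval_pair L hu' hv') f'

/-- In particular a one-variable series read in the variable `Xᵢ` evaluates to `f(u)` resp.
`f(v)`. [cite: SilvermanAEC2009, IV.1] -/
theorem padicAlgEval₂_subst_X (hf : IsPadicInt f) (hu : ‖u‖ < 1) (hv : ‖v‖ < 1) (i : Fin 2) :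
    padicAlgEval₂ L (f.subst (MvPowerSeries.X i : MvPowerSeries (Fin 2) ℚ_[p])) u v =
      padicAlgEval L f (![u, v] i) := by
  rw [padicAlgEval₂_subst hf (IsPadicInt.X i) (MvPowerSeries.constantCoeff_X i) hu hv,
    padicAlgEval₂_X]

/-- **Evaluation commutes with substitution of a pair of series**:
`F(A, B)(u, v) = F(A(u,v), B(u,v))` for `F, A, B ∈ ℤ_p⟦u, v⟧`, `A(0,0) = B(0,0) = 0`.
[cite: BourbakiAlgebraII2003, Ch. IV §4 no. 3] [cite: SilvermanAEC2009, IV.1] -/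
theorem padicAlgEval₂_substPair {A B : MvPowerSeries (Fin 2) ℚ_[p]} (hF : IsPadicInt F)
    (hA : IsPadicInt A) (hB : IsPadicInt B) (hA0 : MvPowerSeries.constantCoeff A = 0)
    (hB0 : MvPowerSeries.constantCoeff B = 0) (hu : ‖u‖ < 1) (hv : ‖v‖ < 1) :
    padicAlgEval₂ L (MvPowerSeries.subst ![A, B] F) u v =
      padicAlgEval₂ L F (padicAlgEval₂ L A u v) (padicAlgEval₂ L B u v) := by
  have hAuv : ‖padicAlgEval₂ L A u v‖ < 1 := norm_padicAlgEval₂_lt_one hA hA0 hu hv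
  have hBuv : ‖padicAlgEval₂ L B u v‖ < 1 := norm_padicAlgEval₂_lt_one hB hB0 hu hv
  obtain ⟨F', rfl⟩ := isPadicInt_iff_exists_map.mp hF
  obtain ⟨A', rfl⟩ := isPadicInt_iff_exists_map.mp hA
  obtain ⟨B', rfl⟩ := isPadicInt_iff_exists_map.mp hB
  obtain ⟨u, rfl, hu'⟩ := exists_unitBall_coe_eq_of_norm_lt_one L hu
  obtain ⟨v, rfl, hv'⟩ := exists_unitBall_coe_eq_of_norm_lt_one L hv
  have hA0' : MvPowerSeries.constantCoeff A' = 0 := by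
    apply PadicInt.coe_eq_zero.mp
    rw [MvPowerSeries.constantCoeff_map] at hA0
    exact hA0
  have hB0' : MvPowerSeries.constantCoeff B' = 0 := by
    apply PadicInt.coe_eq_zero.mp
    rw [MvPowerSeries.constantCoeff_map] at hB0
    exact hB0
  have hs : MvPowerSeries.HasSubst ![A', B'] :=
    MvPowerSeries.hasSubst_of_constantCoeff_zero fun i => by fin_cases i <;> assumption
  have hmap : (![A'.map PadicInt.Coe.ringHom, B'.map PadicInt.Coe.ringHom] :
      Fin 2 → MvPowerSeries (Fin 2) ℚ_[p]) = fun i => (![A', B'] i).map PadicInt.Coe.ringHom := by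
    funext i; fin_cases i <;> rfl
  rw [padicAlgEval₂_map A' hu' hv'] at hAuv ⊢
  rw [padicAlgEval₂_map B' hu' hv'] at hBuv ⊢
  have hAuv' : ‖((MvPowerSeries.eval₂ (coeffHom L) ![u, v] A' : unitBall L) : L)‖ < 1 := hAuv
  have hBuv' : ‖((MvPowerSeries.eval₂ (coeffHom L) ![u, v] B' : unitBall L) : L)‖ < 1 := hBuv
  rw [hmap, ← MvPowerSeries.map_subst hs, padicAlgEval₂_map _ hu' hv',
    padicAlgEval₂_map F' hAuv' hBuv', unitBall_eval₂_subst L hs (unitBall_hasEval_pair L hu' hv')]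
  congr 2
  funext s; fin_cases s <;> simp

end TwoVar

end Eval

end Literature.NumberTheory.EllipticCurves

end
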